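import Summits.Ventures.PercRepro.RankLevelSetUpFiveRankFive
import Summits.Ventures.PercRepro.RankLevelSetUpFiveDeletion

/-! # RankLevelSetUpNullityFive — (↑) AT LEVEL `5` ON EVERY MATROID OF NULLITY `≤ 5` MODULO THE COLOOP RESIDUE (P)
ON THE COLOOP-FREE MATROIDS WITHOUT A SERIES TRIPLE, AND UNCONDITIONALLY ON THE MATROIDS WITH A LINE-SPARSE DUAL
(night-1 g40; dossier §52.9, §52.14; on `RankLevelSetUpFiveRankFive` and `RankLevelSetUpFiveDeletion`)

Strong induction on `#E` inside a class `P` of matroids closed under contraction and under the deletion of a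
coloop: a loop kills the through-`b` family; nullity `≤ 4` is `upAt_five_of_nullity_le_four`; on nullity `5` a
coloop is removed by `upAt_of_isColoop` (levels `5` and `4` of the deletion) or **`upAt_self_of_isColoop_five`**
(`b` the coloop: `D_4 ≤ D_5 ≤ D_6` of the deletion by Mono's steps `4` and `5`), a series class of `≥ 3` elements
on a coloop-free matroid by `upAt_five_of_mem_seriesClass_rank_five` / `upAt_five_of_seriesClass_rank_five` (the
class-cut with the inductive hypothesis on the contractions), and a coloop-free matroid without a series triple by
the deletion-averaging step `upAt_five_of_contract_of_residue` with the inductive hypothesis on the contractions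
`M ／ x` and the residue (P). With `P = True` this is **`upAt_five_of_nullity_five_of_residue`** — (↑)₅ on every
matroid of nullity `≤ 5` with `≥ 12` elements modulo `UpFiveDeletionResidue` on the loopless coloop-free matroids of
nullity `5` WITHOUT A SERIES TRIPLE; with `P = LineSparse M✶` (closed under both operations:
`lineSparse_contract`, `lineSparse_delete_coloop`) the residue is a theorem and **`upAt_five_of_lineSparse`** is
UNCONDITIONAL. Every declaration has a docstring; imports: the cell's own modules and Mathlib only.
Axioms: standard. -/

namespace PercRepro

open Set Matroid

variable {α : Type}

/-- `rk M✶ ≤ 5` and `¬ rk M✶ ≤ 4` give `rk M✶ = 5`. -/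
lemma eRank_dual_eq_five_of_not_le_four (M : Matroid α) (hν : M✶.eRank ≤ 5) (h4 : ¬ M✶.eRank ≤ 4) :
    M✶.eRank = 5 := by
  have hne : M✶.eRank ≠ ⊤ := ne_top_of_le_ne_top (by decide) hν
  obtain ⟨m, hm⟩ := ENat.ne_top_iff_exists.mp hne
  rw [← hm] at hν h4 ⊢
  have h1 : m ≤ 5 := by exact_mod_cast hν
  have h2 : ¬ m ≤ 4 := fun h => h4 (by exact_mod_cast h)
  have : m = 5 := by omega
  rw [this]; rfl

/-- **(↑) AT LEVEL `5` AT A COLOOP `c`** (`12 ≤ #E`): `T_5(c) = D_4(M ＼ c)` and `V_6(c) = D_6(M ＼ c)`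
(`through_ncard_self_of_isColoop`, `avoid_ncard_self_of_isColoop`), and `D_4 ≤ D_5 ≤ D_6` on the deletion by Mono's
steps `4` and `5` (`biIndepCount_four_le_five`, `biIndepCount_five_le_six`; the exact middle `#E − 1 = 11` by
complementation). -/
theorem upAt_self_of_isColoop_five (M : Matroid α) [M.Finite] {c : α} (hc : M.IsColoop c) (hn : 12 ≤ M.E.ncard) :
    BiIndepUpAt M c 5 := by
  haveI : (M.delete {c}).Finite := ⟨M.ground_finite.subset Set.sdiff_subset⟩
  unfold BiIndepUpAt
  rw [through_ncard_self_of_isColoop M hc 4, avoid_ncard_self_of_isColoop M hc 6]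
  have hcard : (M.delete {c}).E.ncard = M.E.ncard - 1 := by
    rw [Matroid.delete_ground, Set.ncard_sdiff_singleton_of_mem hc.mem_ground]
  have h45 : biIndepCount (M.delete {c}) 4 ≤ biIndepCount (M.delete {c}) 5 :=
    biIndepCount_four_le_five (M.delete {c}) (by rw [hcard]; omega)
  rcases Nat.lt_or_ge 12 M.E.ncard with hlt | hge
  · exact h45.trans (biIndepCount_five_le_six (M.delete {c}) (by rw [hcard]; omega))
  · have h11 : (M.delete {c}).E.ncard = 11 := by rw [hcard]; omega
    have h := biIndepCount_compl (M.delete {c}) 5 (by rw [h11]; norm_num)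
    rw [h11] at h
    have e : (11 : ℕ) - 5 = 6 := rfl
    rw [e] at h
    rw [h]
    exact h45

/-- **(↑) AT LEVEL `5` ON A CLASS OF MATROIDS OF NULLITY `≤ 5` CLOSED UNDER CONTRACTION AND UNDER THE DELETION OF
A COLOOP, FROM THE RESIDUE (P) ON ITS LOOPLESS COLOOP-FREE MEMBERS OF NULLITY `5` WITHOUT A SERIES TRIPLE**:
strong induction on `#E`. -/
theorem upAt_five_of_class_of_residue (P : Matroid α → Prop)
    (hPc : ∀ (M : Matroid α) (D : Set α), P M → P (M.contract D))
    (hPd : ∀ (M : Matroid α) (c : α), M.IsColoop c → P M → P (M.delete {c}))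
    (hres : ∀ (M : Matroid α) [M.Finite], P M → (∀ e, ¬ M.IsLoop e) → (∀ e, ¬ M.IsColoop e) → NoSeriesTriple M →
      M✶.eRank = 5 → 12 ≤ M.E.ncard → ∀ b ∈ M.E, UpFiveDeletionResidue M b) :
    ∀ n : ℕ, ∀ (M : Matroid α) [M.Finite], P M → M.E.ncard = n → M✶.eRank ≤ 5 → 12 ≤ n →
      ∀ b ∈ M.E, BiIndepUpAt M b 5 := by
  intro n
  induction n using Nat.strong_induction_on with
  | _ n ih =>
    intro M _ hPM hn hν h12 b hb
    by_cases hloop : ∃ ℓ, M.IsLoop ℓ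
    · obtain ⟨ℓ, hℓ⟩ := hloop
      unfold BiIndepUpAt
      have : {W ∈ biIndep M 5 | b ∈ W} = ∅ := by
        rw [biIndep_eq_empty_of_isLoop M hℓ 5]
        ext W; simp
      rw [this, Set.ncard_empty]
      exact Nat.zero_le _
    simp only [not_exists] at hloop
    by_cases h4 : M✶.eRank ≤ 4
    · exact upAt_five_of_nullity_le_four M h4 (by omega) hb
    have h5 : M✶.eRank = 5 := eRank_dual_eq_five_of_not_le_four M hν h4
    -- a coloop
    by_cases hcol : ∃ c, M.IsColoop c
    · obtain ⟨c, hc⟩ := hcol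
      haveI := delete_finite' M c
      have hcard : (M.delete {c}).E.ncard = n - 1 := by
        rw [Matroid.delete_ground, Set.ncard_sdiff_singleton_of_mem hc.mem_ground, hn]
      have hν' : (M.delete {c})✶.eRank ≤ 5 := (eRank_dual_delete_isColoop_le M hc).trans hν
      by_cases hbc : b = c
      · subst hbc
        exact upAt_self_of_isColoop_five M hc (by omega)
      · have hbM : b ∈ (M.delete {c}).E := by
          rw [Matroid.delete_ground]; exact ⟨hb, by simpa using hbc⟩
        refine upAt_of_isColoop M hc hbc (k := 4) ?_ ?_
        · rcases Nat.lt_or_ge 12 n with hlt | hge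
          · exact ih (n - 1) (by omega) (M.delete {c}) (hPd M c hc hPM) hcard hν' (by omega) b hbM
          · exact upAt_of_ncard_eq_middle (M.delete {c}) hbM (k := 5) (by rw [hcard]; omega)
        · by_cases h4' : (M.delete {c})✶.eRank ≤ 4
          · exact upAt_of_nullity_four (n - 1) (M.delete {c}) hcard h4' 4 le_rfl (by omega) b hbM
          · refine upAt_of_lt_nullity (M.delete {c}) ?_
            rw [eRank_dual_eq_five_of_not_le_four (M.delete {c}) hν' h4']
            norm_num
    simp only [not_exists] at hcol
    -- coloop-free of nullity `5`: a series triple, or the deletion-averaging step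
    by_cases hnt : NoSeriesTriple M
    · refine upAt_five_of_contract_of_residue M hloop hb (by omega) ?_ (hres M hPM hloop hcol hnt h5 (by omega) b hb)
      intro x hx
      haveI : (M.contract {x}).Finite := inferInstance
      have hcard : (M.contract {x}).E.ncard = n - 1 := by
        rw [ncard_ground_contract_singleton M hx.1, hn]
      have hν' : (M.contract {x})✶.eRank ≤ 5 := (eRank_dual_contract_le M {x}).trans hν
      have hbM : b ∈ (M.contract {x}).E := by
        rw [Matroid.contract_ground]
        exact ⟨hb, fun h => hx.2 (by rw [Set.mem_singleton_iff] at h ⊢; exact h.symm)⟩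
      rcases Nat.lt_or_ge 12 n with hlt | hge
      · exact ih (n - 1) (by omega) (M.contract {x}) (hPc M {x} hPM) hcard hν' (by omega) b hbM
      · exact upAt_of_ncard_eq_middle (M.contract {x}) hbM (k := 5) (by rw [hcard]; omega)
    · obtain ⟨p, hp, hq⟩ := three_le_ncard_seriesClass_of_not_noSeriesTriple M hnt
      by_cases hbP : b ∈ M✶.closure {p}
      · exact upAt_five_of_mem_seriesClass_rank_five M hcol h5 hp hq hbP
      · refine upAt_five_of_seriesClass_rank_five M hcol h5 hp hq hb hbP ?_
        intro D hDP hpD hDne h12'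
        haveI : (M.contract D).Finite := Matroid.contract_finite
        have hDE : D ⊆ M.E := by
          rw [← Matroid.dual_ground (M := M)]; exact hDP.trans (M✶.closure_subset_ground _)
        have hlt : (M.contract D).E.ncard < M.E.ncard := by
          rw [Matroid.contract_ground, Set.ncard_sdiff hDE (M.ground_finite.subset hDE)]
          have := Set.ncard_le_ncard hDE M.ground_finite
          have hpos : 0 < D.ncard := (Set.ncard_pos (M.ground_finite.subset hDE)).mpr hDne
          omega
        have hν' : (M.contract D)✶.eRank ≤ 5 := (eRank_dual_contract_le M D).trans hν
        have hbM : b ∈ (M.contract D).E := by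
          rw [Matroid.contract_ground]; exact ⟨hb, fun h => hbP (hDP h)⟩
        exact ih (M.contract D).E.ncard (by omega) (M.contract D) (hPc M D hPM) rfl hν' h12' b hbM

/-- **(↑) AT LEVEL `5` ON EVERY MATROID OF NULLITY `≤ 5` WITH `≥ 12` ELEMENTS, AT EVERY ELEMENT, MODULO THE COLOOP
RESIDUE (P) ON THE LOOPLESS COLOOP-FREE MATROIDS OF NULLITY `5` WITHOUT A SERIES TRIPLE.** -/
theorem upAt_five_of_nullity_five_of_residue
    (hres : ∀ (M : Matroid α) [M.Finite], (∀ e, ¬ M.IsLoop e) → (∀ e, ¬ M.IsColoop e) → NoSeriesTriple M →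
      M✶.eRank = 5 → 12 ≤ M.E.ncard → ∀ b ∈ M.E, UpFiveDeletionResidue M b)
    (M : Matroid α) [M.Finite] (hν : M✶.eRank ≤ 5) (hn : 12 ≤ M.E.ncard) {b : α} (hb : b ∈ M.E) :
    BiIndepUpAt M b 5 :=
  upAt_five_of_class_of_residue (fun _ => True) (fun _ _ _ => trivial) (fun _ _ _ _ => trivial)
    (fun M' _ _ hl hcol hnt h5 h12 b' hb' => hres M' hl hcol hnt h5 h12 b' hb') M.E.ncard M trivial rfl hν hn b hb

/-- **Line-sparseness of the dual is preserved by contraction**: `(M ／ D)✶ = M✶ ＼ D`, and the rank of a subset of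
`E ∖ D` is the same in `M✶ ＼ D` and in `M✶`. -/
lemma lineSparse_contract (M : Matroid α) (D : Set α) (hls : LineSparse M✶) : LineSparse (M.contract D)✶ := by
  intro Y hYE hY
  rw [Matroid.dual_contract] at hYE hY ⊢
  rw [Matroid.delete_ground] at hYE
  rw [Matroid.delete_eq_restrict, Matroid.restrict_eRk_eq _ hYE] at hY ⊢
  exact hls Y (hYE.trans Set.sdiff_subset) hY

/-- **Line-sparseness of the dual is preserved by the deletion of a coloop**: `(M ＼ c)✶ = M✶ ／ c = M✶ ＼ c` for
the loop `c` of `M✶`. -/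
lemma lineSparse_delete_coloop (M : Matroid α) {c : α} (hc : M.IsColoop c) (hls : LineSparse M✶) :
    LineSparse (M.delete {c})✶ := by
  have hloop : ({c} : Set α) ⊆ M✶.loops := by
    rw [Set.singleton_subset_iff, ← Matroid.isLoop_iff, Matroid.dual_isLoop_iff_isColoop]
    exact hc
  intro Y hYE hY
  rw [Matroid.dual_delete, Matroid.contract_eq_delete_of_subset_loops hloop] at hYE hY ⊢
  rw [Matroid.delete_ground] at hYE
  rw [Matroid.delete_eq_restrict, Matroid.restrict_eRk_eq _ hYE] at hY ⊢
  exact hls Y (hYE.trans Set.sdiff_subset) hY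

/-- **(↑) AT LEVEL `5` ON EVERY MATROID OF NULLITY `≤ 5` WITH `≥ 12` ELEMENTS WHOSE DUAL IS LINE-SPARSE, AT EVERY
ELEMENT — UNCONDITIONALLY**: the residue is `upFiveDeletionResidue_of_lineSparse` on every member of the class. -/
theorem upAt_five_of_lineSparse (M : Matroid α) [M.Finite] (hν : M✶.eRank ≤ 5) (hls : LineSparse M✶)
    (hn : 12 ≤ M.E.ncard) {b : α} (hb : b ∈ M.E) : BiIndepUpAt M b 5 :=
  upAt_five_of_class_of_residue (fun M' => LineSparse M'✶) (fun M' D h => lineSparse_contract M' D h)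
    (fun M' _ hc h => lineSparse_delete_coloop M' hc h)
    (fun M' _ hls' _ _ _ h5 h12 b' _ => upFiveDeletionResidue_of_lineSparse M' (le_of_eq h5) hls' h12 b')
    M.E.ncard M hls rfl hν hn b hb

end PercRepro
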